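import Summits.QuantumFields.YangMills.Theorems.LangevinControlUVOSLegsAtWeakCouplingCSketchSplit
import Summits.QuantumFields.YangMills.Theorems.OSLegsAtWeakCouplingC.Negative.FalseWithoutTwoPoint
import Summits.QuantumFields.YangMills.Theorems.OSLegsAtWeakCouplingC.Negative.WeakCouplingConjunct
import Summits.QuantumFields.YangMills.Theorems.OSLegsAtWeakCouplingC.Negative.GermAtInfinity
import HarnessLib

/-!
# Crux `OSLegsAtWeakCouplingC` (stmt-QuantumFields-16207) — line `axis-cross-analyticity-e1-locality`: planner skeleton (crux-plan, gen 1)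

Card: `Cruxes/OSLegsAtWeakCouplingC/Ideas/axis-cross-analyticity-e1-locality.md` (ideator 2, r1; triage r1-1 / r1-2: pass, pass).
Line card: `Lines/axis-cross-analyticity-e1-locality.md`.  Planner: `planner-cruxplan-stmt-QuantumFields-16207-axis-cross-analytici-0`,
2026-08-17.

## STATUS — READ FIRST (lead provers): COMPLETE AS A REDUCTION; NOTHING TO REBUILD

This card's line was already built, under the working name `Sketch`, by leads `prover-line-stmt-QuantumFields-16207-0`, `-c1` … `-c9`
(2026-08-16T19:34Z → 2026-08-17T06:35Z): `Lines/Sketch.lean` v10c (registered sha `ba136314…`), `Lines/Sketch.md`, `Lines/Sketch-dead.md`.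
The card's LEVER is a landed theorem — `…Cruxes.OSLegsAtWeakCouplingC.Sketch.stub_locality` (Theorems/…CStubLocality.lean, p131928 + 10
helper files: one-slot semigroup holomorphy along `e₀` and `e₁`, flat tube / cross theorem on convex conic chambers reaching the germ,
identity theorem, null-set closure) — and so is EVERY other line-internal lemma (`stub_density` p123998, `stub_cluster` p125365,
`stub_hypercubic` p115564, `stub_rope` p133794, `stubPin_of_continuous`, `stub_collar6`, `fbl_of_fbl6`, `stub_lower`, `stub_growth`,
`stub_gap`) and every composition (…SketchConditional p132819 … …SketchPencil2 p137364, …SketchRetype p138533, necessity …SketchNecessityNT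
p138920 / …SketchNecessityE1 p139098, split glue …SketchSplit p140922).  What remains is not line content but the crux's own open-problem
content, isolated — kernel-checked — into the THREE statements below, two of them PROVABLY NECESSARY for the crux along the witnessing
scheme (NT: `conclC_imp_latticeNontrivial` p138920; lattice E1: `conclC_imp_latticeRotationDefect` p139098).  Lead c9 declared the line
`line-dead` = complete as a reduction (L5 clause 3); this planner, to whom the chain returned (prover.md L4/L5: "the planner promotes it
to an item"), submits the three stubs to the route as the crux's CHILDREN — glued split `--split OSLegsAtWeakCouplingC --into children.json
--glue-by …Sketch.osLegsAtWeakCouplingC_of_subs`; the gate's answer is recorded in the line card § Split.  Consequently: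

* the three `stub_*` below are, byte for byte, the statements of the children `UVHyperscalingC` / `LargeTorusNonTrivialityC` /
  `LatticeWardGermC` (route vocabulary: only `Mathlib` + `Summits.QuantumFields.Statement` constants; 3534 / 3837 / 3589 characters) and of
  the three stubs registered on the item since v10b — same NAMES kept on purpose so registrations, `--supports` bookkeeping and the
  disprover's `-- Targets` carry over;
* each stub is CRUX-SIZED (non-perturbative control of 4D lattice Yang–Mills at weak coupling on NON-femto volumes: UV stability with
  composite insertions on all volumes / femto → large-torus transfer of non-triviality / dynamical rotation restoration) — a lead seated
  on this file should NOT open L2/L3 on them: they close through their own item chains, and `OSLegsAtWeakCouplingC_of` then closes the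
  parent by modus ponens;
* `OSLegsAtWeakCouplingC_of` is stated in the crux-plan implication form `S₁ → S₂ → S₃ → OSLegsAtWeakCouplingC` and its proof IS the landed
  glue (no sorry, no reference to the stubs): the audit's `proof-of-item` line is the kernel's word that the three statements suffice.

## Disproof used (Cruxes/OSLegsAtWeakCouplingC/Disproof.lean v2, `-- Targets: none`; the three landed Negative files are imported above
so this check runs against them)

* §2 `cruxC_false_without_twoPoint` / `Negative.osLegsC_false_without_twoPoint` (any proof must use H1, at least `∀ β, 0 < a β`): honoured —
  H1 is a hypothesis of all three stubs and is consumed (i) by `stub_largeTorusNonTriviality` (the femto amplitude is what a transfer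
  mechanism propagates: card `inherited-amplitude-gates`), (ii) inside the landed glue through `stubPin_of_continuous` (H1's `Γ` + IVT pin
  `a` to the physical scale) and `a > 0`, `a → 0`;
* §3 `conclC_sans_nontriviality` (everything but `IsNontrivial ∧ IsNonGaussian` is free): honoured — the stub set is exactly E0′ / NT / E1,
  the content §3 isolates; nothing free is re-proved;
* §5 `conclC_congr_above`, `scheme_tori_eventually_not_femto` (the crux is a germ property at `β = +∞`; H1/H2 are silent on the scheme's
  tori): honoured — NTC is stated on LARGE tori `a(β)·L ≥ Λ₅` and E1C along the scheme (`a_k L_k → ∞`), i.e. the card's design constraint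
  "read the germ on the scheme's tori after an asymptotic bridge, never on femto tori" is built into the statements;
* §7 `not_forall_scheme_strengtheningC` (the ∀-scheme form is FALSE): respected — no stub quantifies the CONCLUSION over all schemes; E1C's
  `∀ sch` ranges over schemes in units `a` with `β_k → ∞` inside the bundle ranges and concludes a Ward DEFECT → 0, not OS data;
* negatives index (`ledger negatives --problem QuantumFields`): DiagonalMirrorRP (stmt-9665) avoided — axis mirrors only (the landed
  `stub_locality` uses RP along coordinate axes); the QCD negatives are unrelated.  No landed `Negative/*` lemma has an instance among the stubs.
-/

set_option autoImplicit false

open scoped SchwartzMap BigOperators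
open MeasureTheory Filter Topology
open Literature.MathematicalPhysics.QuantumFieldTheory Literature.MathematicalPhysics.QuantumLattice
open Literature.MathematicalPhysics.AQFT Literature.Probability.LatticeModels
open Summit.QuantumFields.YangMills.Theses.LangevinControlUV (OSLegsAtWeakCouplingC)
open Summit.QuantumFields.YangMills.Cruxes.OSLegsAtWeakCouplingC.Sketch (osLegsAtWeakCouplingC_of_subs)

namespace Summit.QuantumFields.YangMills.Cruxes.OSLegsAtWeakCouplingC.AxisCrossAnalyticityE1Locality

/-! ## The registered stubs (the only sorries) — verbatim the three children of the crux -/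

/-- **stub_uvHyperscaling** = child E0′C `LangevinControlUV.UVHyperscalingC` (crux-sized; not worker work).
For every compact simple `G`, faithful unitary `r` and CONTINUOUS unit map `a` carrying H1 (femto two-point package),
H2 (skewness witness), H3 (clustering in units `a`): there are `C ≥ 0`, `β₄`, `ℓ₄ > 0` such that for `β ≥ β₄`, on EVERY
odd torus `(2L+1)⁴`, the centred mixed moment of `n` single-plane plaquette fields at sites of pairwise torus
sup-distance `≥ 2R+4` (`1 ≤ R`, `R·a(β) ≤ ℓ₄`, `4R+8 ≤ L`) is at most `(C/R⁴)ⁿ` — volume-uniform hyperscaling with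
dimension 4 per insertion (≡ `MomentBounds6 G r a`, `Sketch.uvHyperscalingC_pointwise_iff`, `Iff.rfl`).  Mechanism on
file: the landed collar transfer `stub_collar6` derives it, n-uniformly, from the femto boundary law FBL6 (sup over
exteriors of the boundary influence on a plaquette's conditional mean `≤ C₁/depth⁴`) by torus DLR + conditional
independence of disjoint radius-`(R+1)` cubes.  Why it might fail: it is UV stability WITH composite insertions on
all volumes (Bałaban's programme stops at effective actions — barrier `UVStabilityNonUniqueness` is about uniqueness,
not this, but no printed technique delivers insertions volume-uniformly); FBL6 is complete-analyticity strength. -/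
theorem stub_uvHyperscaling :
    open Literature.MathematicalPhysics.QuantumLattice Literature.MathematicalPhysics.AQFT Literature.MathematicalPhysics.QuantumFieldTheory Literature.Probability.LatticeModels in ∀ (G : Type) [Group G] [TopologicalSpace G] [IsTopologicalGroup G] [CompactSpace G], IsCompactSimpleLieGroup G → letI : MeasurableSpace G := borel G; haveI : BorelSpace G := ⟨rfl⟩; ∀ (r : LatticeRep G), ∀ (a : ℝ → ℝ), Continuous a → (∃ (Γ : ℝ → ℝ) (β₀ ℓ₀ c C : ℝ), 0 < ℓ₀ ∧ 0 < c ∧ (∀ β, 0 < a β) ∧ Filter.Tendsto a Filter.atTop (nhds 0) ∧ (∀ s : ℝ, 0 < s → s ≤ ℓ₀ → 0 < Γ s ∧ Γ s ≤ 1) ∧ ∀ (L : ℕ) [NeZero L] (β : ℝ), β₀ ≤ β → (L : ℝ) * a β ≤ ℓ₀ → let P : (Fin 4 → ZMod L) → Fin 4 → Fin 4 → GaugeConfig 4 L G → ℝ := fun x i j U => (r.N : ℝ) - (r.ρ (plaquetteHolonomy U x i j)).trace.re; let E : (GaugeConfig 4 L G → ℝ) → ℝ := fun F => wilsonExpectation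 (d := 4) (L := L) r.ρ β F; let cov : (GaugeConfig 4 L G → ℝ) → (GaugeConfig 4 L G → ℝ) → ℝ := fun F F' => E (fun U => F U * F' U) - E F * E F'; let dist : (Fin 4 → ZMod L) → (Fin 4 → ZMod L) → ℝ := fun x y => Real.sqrt (∑ k : Fin 4, (((x k - y k).valMinAbs : ℤ) : ℝ) ^ 2); (∀ n : ℕ, 1 ≤ n → 8 * n ≤ L → c * Γ ((n : ℝ) * a β) ≤ (n : ℝ) ^ 8 * cov (P 0 0 1) (P (Pi.single (2 : Fin 4) ((n : ℕ) : ZMod L)) 0 1) ∧ (n : ℝ) ^ 8 * cov (P 0 0 1) (P (Pi.single (2 : Fin 4) ((n : ℕ) : ZMod L)) 0 1) ≤ C * Γ ((n : ℝ) * a β)) ∧ (∀ (x y : Fin 4 → ZMod L) (i j i' j' : Fin 4), x ≠ y → i ≠ j → i' ≠ j' → |cov (P x i j) (P y i' j')| * dist x y ^ 8 ≤ C * Γ (dist x y * a β))) → (∃ (Γ₃ : ℝ → ℝ) (β₁ ℓ₁ c₃ : ℝ), 0 < ℓ₁ ∧ 0 < c₃ ∧ (∀ s : ℝ, 0 < s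 → s ≤ ℓ₁ → 0 < Γ₃ s) ∧ ∀ (L : ℕ) [NeZero L] (β : ℝ), β₁ ≤ β → (L : ℝ) * a β ≤ ℓ₁ → let P : (Fin 4 → ZMod L) → Fin 4 → Fin 4 → GaugeConfig 4 L G → ℝ := fun x i j U => (r.N : ℝ) - (r.ρ (plaquetteHolonomy U x i j)).trace.re; let E : (GaugeConfig 4 L G → ℝ) → ℝ := fun F => wilsonExpectation (d := 4) (L := L) r.ρ β F; let cov : (GaugeConfig 4 L G → ℝ) → (GaugeConfig 4 L G → ℝ) → ℝ := fun F F' => E (fun U => F U * F' U) - E F * E F'; ∀ n : ℕ, 1 ≤ n → 8 * n ≤ L → c₃ * Γ₃ ((n : ℝ) * a β) ≤ (n : ℝ) ^ 12 * |E (fun U => P 0 0 1 U * P (Pi.single (2 : Fin 4) ((n : ℕ) : ZMod L)) 0 1 U * P (Pi.single (3 : Fin 4) ((n : ℕ) : ZMod L)) 0 1 U) - E (P 0 0 1) * cov (P (Pi.single (2 : Fin 4) ((n : ℕ) : ZMod L)) 0 1) (P (Pi.single (3 : Fin 4) ((n : ℕ) : ZMod L)) 0 1) - E (P (Pi.single (2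 : Fin 4) ((n : ℕ) : ZMod L)) 0 1) * cov (P 0 0 1) (P (Pi.single (3 : Fin 4) ((n : ℕ) : ZMod L)) 0 1) - E (P (Pi.single (3 : Fin 4) ((n : ℕ) : ZMod L)) 0 1) * cov (P 0 0 1) (P (Pi.single (2 : Fin 4) ((n : ℕ) : ZMod L)) 0 1) - E (P 0 0 1) * E (P (Pi.single (2 : Fin 4) ((n : ℕ) : ZMod L)) 0 1) * E (P (Pi.single (3 : Fin 4) ((n : ℕ) : ZMod L)) 0 1)|) → (∃ (c₁ β₂ : ℝ) (S₁ : ℝ → ℕ), 0 < c₁ ∧ ∀ A B : YMSpecies G, ∃ C : ℝ, ∀ β : ℝ, β₂ ≤ β → ∀ S n : ℕ, S₁ β ≤ S → n ≤ S → |latticeConnectedCorr r.ρ β (2 * S + 1) A.F B.F n| ≤ C * Real.exp (-(c₁ * a β * n))) → ∃ (C β₄ ℓ₄ : ℝ), 0 < ℓ₄ ∧ 0 ≤ C ∧ ∀ β : ℝ, β₄ ≤ β → ∀ (L n : ℕ) (q : Fin n → Fin 4 × Fin 4) (x : Fin n → (Fin 4 → ℤ)) (R : ℕ), (∀ i, (q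 i).1 < (q i).2) → 1 ≤ R → (R : ℝ) * a β ≤ ℓ₄ → 4 * R + 8 ≤ L → (∀ i j : Fin n, i ≠ j → ∃ k : Fin 4, (2 * (R : ℤ) + 4) ≤ |((((x i k - x j k : ℤ) : ZMod (2 * L + 1))).valMinAbs : ℤ)|) → let E : (LGConfig 4 G → ℝ) → ℝ := fun F => ∫ U, F (torusLift (2 * L + 1) U) ∂(wilsonMeasure (d := 4) (L := 2 * L + 1) r.ρ β); let Pl : Fin 4 × Fin 4 → (Fin 4 → ℤ) → LGConfig 4 G → ℝ := fun p y U => plaquetteObs r.ρ 0 p.1 p.2 (configShift (-y) U); |E (fun U => ∏ i, (Pl (q i) (x i) U - E (Pl (q i) (x i))))| ≤ (C / (R : ℝ) ^ 4) ^ n := by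
  sorry

/-- **stub_largeTorusNonTriviality** = child NTC `LangevinControlUV.LargeTorusNonTrivialityC` (crux-sized; NECESSARY for
the crux along the witnessing scheme, `conclC_imp_latticeNontrivial` p138920).  For every `G`, `r`, continuous `a`
carrying H1–H3: ONE quantifier block of real test functions `v` (positive-time support), `f, g, h` (pairwise disjoint
supports), `ε > 0`, `β₅`, `Λ₅` such that on every torus with `a(β)·L ≥ Λ₅` at every `β ≥ β₅`: `ε ≤ Q2(θv, v)` (the
smeared truncated two-point function of the action density at `c_curv = a⁻⁴`, written as the bare double lattice sum)
AND `ε ≤ |Q3(f, g, h)|` (connected three-point) — ⇔ `LowerBounds G r a` (`Sketch.largeTorusNonTrivialityC_pointwise_iff`).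
Mechanism on file: the landed `stub_lower` derives it from FBL ∧ FC2 ∧ FC3 (conditional lower bounds in femto cubes
uniform in the exterior); card `inherited-amplitude-gates` (triage: pass, with typing repairs) is the one inheritance
mechanism for the two-point half.  Why it might fail: a k-uniform LOWER bound on large-torus correlations is the
femto → bulk decoupling itself (Disproof §5: H1/H2 are silent there); the three-point clause is two-loop precision
(the density's κ₃ vanishes at tree level). -/
theorem stub_largeTorusNonTriviality :
    open Literature.MathematicalPhysics.QuantumLattice Literature.MathematicalPhysics.AQFT Literature.MathematicalPhysics.QuantumFieldTheory Literature.Probability.LatticeModels in ∀ (G : Type) [Group G] [TopologicalSpace G] [IsTopologicalGroup G] [CompactSpace G], IsCompactSimpleLieGroup G → letI : MeasurableSpace G := borel G; haveI : BorelSpace G := ⟨rfl⟩; ∀ (r : LatticeRep G), ∀ (a : ℝ → ℝ), Continuous a → (∃ (Γ : ℝ → ℝ) (β₀ ℓ₀ c C : ℝ), 0 < ℓ₀ ∧ 0 < c ∧ (∀ β, 0 < a β) ∧ Filter.Tendsto a Filter.atTop (nhds 0) ∧ (∀ s : ℝ, 0 < s → s ≤ ℓ₀ → 0 < Γ s ∧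 Γ s ≤ 1) ∧ ∀ (L : ℕ) [NeZero L] (β : ℝ), β₀ ≤ β → (L : ℝ) * a β ≤ ℓ₀ → let P : (Fin 4 → ZMod L) → Fin 4 → Fin 4 → GaugeConfig 4 L G → ℝ := fun x i j U => (r.N : ℝ) - (r.ρ (plaquetteHolonomy U x i j)).trace.re; let E : (GaugeConfig 4 L G → ℝ) → ℝ := fun F => wilsonExpectation (d := 4) (L := L) r.ρ β F; let cov : (GaugeConfig 4 L G → ℝ) → (GaugeConfig 4 L G → ℝ) → ℝ := fun F F' => E (fun U => F U * F' U) - E F * E F'; let dist : (Fin 4 → ZMod L) → (Fin 4 → ZMod L) → ℝ := fun x y => Real.sqrt (∑ k : Fin 4, (((x k - y k).valMinAbs : ℤ) : ℝ) ^ 2); (∀ n : ℕ, 1 ≤ n → 8 * n ≤ L → c * Γ ((n : ℝ) * a β) ≤ (n : ℝ) ^ 8 * cov (P 0 0 1) (P (Pi.single (2 : Fin 4) ((n : ℕ) : ZMod L)) 0 1) ∧ (n : ℝ) ^ 8 * cov (P 0 0 1) (P (Pi.single (2 : Fin 4) ((n : ℕ) : ZMod L)) 0 1) ≤ C * Γ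 ((n : ℝ) * a β)) ∧ (∀ (x y : Fin 4 → ZMod L) (i j i' j' : Fin 4), x ≠ y → i ≠ j → i' ≠ j' → |cov (P x i j) (P y i' j')| * dist x y ^ 8 ≤ C * Γ (dist x y * a β))) → (∃ (Γ₃ : ℝ → ℝ) (β₁ ℓ₁ c₃ : ℝ), 0 < ℓ₁ ∧ 0 < c₃ ∧ (∀ s : ℝ, 0 < s → s ≤ ℓ₁ → 0 < Γ₃ s) ∧ ∀ (L : ℕ) [NeZero L] (β : ℝ), β₁ ≤ β → (L : ℝ) * a β ≤ ℓ₁ → let P : (Fin 4 → ZMod L) → Fin 4 → Fin 4 → GaugeConfig 4 L G → ℝ := fun x i j U => (r.N : ℝ) - (r.ρ (plaquetteHolonomy U x i j)).trace.re; let E : (GaugeConfig 4 L G → ℝ) → ℝ := fun F => wilsonExpectation (d := 4) (L := L) r.ρ β F; let cov : (GaugeConfig 4 L G → ℝ) → (GaugeConfig 4 L G → ℝ) → ℝ := fun F F' => E (fun U => F U * F' U) - E F * E F'; ∀ n : ℕ, 1 ≤ n → 8 * n ≤ L → c₃ * Γ₃ ((n : ℝ) * a β) ≤ (n : ℝ)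 ^ 12 * |E (fun U => P 0 0 1 U * P (Pi.single (2 : Fin 4) ((n : ℕ) : ZMod L)) 0 1 U * P (Pi.single (3 : Fin 4) ((n : ℕ) : ZMod L)) 0 1 U) - E (P 0 0 1) * cov (P (Pi.single (2 : Fin 4) ((n : ℕ) : ZMod L)) 0 1) (P (Pi.single (3 : Fin 4) ((n : ℕ) : ZMod L)) 0 1) - E (P (Pi.single (2 : Fin 4) ((n : ℕ) : ZMod L)) 0 1) * cov (P 0 0 1) (P (Pi.single (3 : Fin 4) ((n : ℕ) : ZMod L)) 0 1) - E (P (Pi.single (3 : Fin 4) ((n : ℕ) : ZMod L)) 0 1) * cov (P 0 0 1) (P (Pi.single (2 : Fin 4) ((n : ℕ) : ZMod L)) 0 1) - E (P 0 0 1) * E (P (Pi.single (2 : Fin 4) ((n : ℕ) : ZMod L)) 0 1) * E (P (Pi.single (3 : Fin 4) ((n : ℕ) : ZMod L)) 0 1)|) → (∃ (c₁ β₂ : ℝ) (S₁ : ℝ → ℕ), 0 < c₁ ∧ ∀ A B : YMSpecies G, ∃ C : ℝ, ∀ β : ℝ, β₂ ≤ β → ∀ S n : ℕ, S₁ β ≤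 S → n ≤ S → |latticeConnectedCorr r.ρ β (2 * S + 1) A.F B.F n| ≤ C * Real.exp (-(c₁ * a β * n))) → ∃ (v f g h : SchwartzMap (EuclideanSpace ℝ (Fin 4)) ℝ) (ε β₅ Λ₅ : ℝ), tsupport v ⊆ {y : EuclideanSpace ℝ (Fin 4) | 0 < y 0} ∧ Disjoint (tsupport f) (tsupport g) ∧ Disjoint (tsupport g) (tsupport h) ∧ Disjoint (tsupport f) (tsupport h) ∧ 0 < ε ∧ ∀ β : ℝ, β₅ ≤ β → ∀ L : ℕ, Λ₅ ≤ a β * L → let E : (LGConfig 4 G → ℝ) → ℝ := fun F => ∫ U, F (torusLift (2 * L + 1) U) ∂(wilsonMeasure (d := 4) (L := 2 * L + 1) r.ρ β); let D : (Fin 4 → ℤ) → LGConfig 4 G → ℝ := fun x U => r.curvature.F (configShift (-x) U); (ε ≤ ∑ x ∈ box 4 L, ∑ y ∈ box 4 L, thetaTest 4 v (a β • siteToE x) * v (a β • siteToE y) * (E (fun U => D x U * D y U) - E (D x) * E (D y))) ∧ (ε ≤ |∑ x ∈ box 4 L, ∑ y ∈ box 4 L, ∑ z ∈ box 4 L, f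 (a β • siteToE x) * g (a β • siteToE y) * h (a β • siteToE z) * (E (fun U => D x U * D y U * D z U) - E (D x) * E (fun U => D y U * D z U) - E (D y) * E (fun U => D x U * D z U) - E (D z) * E (fun U => D x U * D y U) + 2 * (E (D x) * E (D y) * E (D z)))|) := by
  sorry

/-- **stub_latticeWardGerm** = child E1C `LangevinControlUV.LatticeWardGermC` (crux-sized; NECESSARY in lattice form,
`conclC_imp_latticeRotationDefect` p139098; barrier `RegularisationDichotomy`).  For every `G`, `r`, continuous `a`
carrying H1 and H3, and GIVEN E0′ (the conclusion of `stub_uvHyperscaling` as a hypothesis): along every scheme in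
units `a` with `β_k → ∞` inside the bundle ranges there is `r₀ > 0` such that for `n ≥ 2` the centred lattice `n`-point
distributions of the action density annihilate, as `k → ∞`, the `(x₀,x₁)`-rotation-generator derivative `D` of every
compactly supported, separated, off-diagonal test function `F` of diameter `< r₀`.  THIS IS WHERE THE CARD'S LEVER ACTS:
downstream of this stub everything is landed — lattice Ward on the germ ⇒ germ Ward identity of every subsequential limit
⇒ planar det-1 germ invariance ⇒ `stub_locality` (RP along two axes + cross theorem: germ invariance ⇒ global invariance,
p131928) ⇒ SO(4) — so the crux's E1 import is exactly its GERM, read on the scheme's large tori.  Why it might fail: the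
germ is dynamical (irrelevant dimension-6 W(B₄)-scalar operators × a²·logs must die in the continuum limit WITH
insertions — no small parameter beyond perturbation theory; barrier RegularisationDichotomy); numerically falsifiable
(a² → 0 extrapolation of the Pythagorean defect to a ZERO intercept, DavoudiSavage2012 protocol; tree-level anatomy j019560). -/
theorem stub_latticeWardGerm :
    open Literature.MathematicalPhysics.QuantumLattice Literature.MathematicalPhysics.AQFT Literature.MathematicalPhysics.QuantumFieldTheory Literature.Probability.LatticeModels in ∀ (G : Type) [Group G] [TopologicalSpace G] [IsTopologicalGroup G] [CompactSpace G], IsCompactSimpleLieGroup G → letI : MeasurableSpace G := borel G; haveI : BorelSpace G := ⟨rfl⟩; ∀ (r : LatticeRep G), ∀ (a : ℝ → ℝ), Continuous a → (∃ (Γ : ℝ → ℝ) (β₀ ℓ₀ c C : ℝ), 0 < ℓ₀ ∧ 0 < c ∧ (∀ β, 0 < a β) ∧ Filter.Tendsto a Filter.atTop (nhds 0) ∧ (∀ s : ℝ, 0 < s → s ≤ ℓ₀ → 0 < Γ s ∧ Γ s ≤ 1) ∧ ∀ (L : ℕ) [NeZero L] (β : ℝ), β₀ ≤ β → (L : ℝ)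 * a β ≤ ℓ₀ → let P : (Fin 4 → ZMod L) → Fin 4 → Fin 4 → GaugeConfig 4 L G → ℝ := fun x i j U => (r.N : ℝ) - (r.ρ (plaquetteHolonomy U x i j)).trace.re; let E : (GaugeConfig 4 L G → ℝ) → ℝ := fun F => wilsonExpectation (d := 4) (L := L) r.ρ β F; let cov : (GaugeConfig 4 L G → ℝ) → (GaugeConfig 4 L G → ℝ) → ℝ := fun F F' => E (fun U => F U * F' U) - E F * E F'; let dist : (Fin 4 → ZMod L) → (Fin 4 → ZMod L) → ℝ := fun x y => Real.sqrt (∑ k : Fin 4, (((x k - y k).valMinAbs : ℤ) : ℝ) ^ 2); (∀ n : ℕ, 1 ≤ n → 8 * n ≤ L → c * Γ ((n : ℝ) * a β) ≤ (n : ℝ) ^ 8 * cov (P 0 0 1) (P (Pi.single (2 : Fin 4) ((n : ℕ) : ZMod L)) 0 1) ∧ (n : ℝ) ^ 8 * cov (P 0 0 1) (P (Pi.single (2 : Fin 4) ((n : ℕ) : ZMod L)) 0 1) ≤ C * Γ ((n : ℝ) * a β)) ∧ (∀ (x y : Fin 4 → ZMod L) (i j i' j' : Fin 4), x ≠ y →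 i ≠ j → i' ≠ j' → |cov (P x i j) (P y i' j')| * dist x y ^ 8 ≤ C * Γ (dist x y * a β))) → (∃ (c₁ β₂ : ℝ) (S₁ : ℝ → ℕ), 0 < c₁ ∧ ∀ A B : YMSpecies G, ∃ C : ℝ, ∀ β : ℝ, β₂ ≤ β → ∀ S n : ℕ, S₁ β ≤ S → n ≤ S → |latticeConnectedCorr r.ρ β (2 * S + 1) A.F B.F n| ≤ C * Real.exp (-(c₁ * a β * n))) → (∃ (C β₄ ℓ₄ : ℝ), 0 < ℓ₄ ∧ 0 ≤ C ∧ ∀ β : ℝ, β₄ ≤ β → ∀ (L n : ℕ) (q : Fin n → Fin 4 × Fin 4) (x : Fin n → (Fin 4 → ℤ)) (R : ℕ), (∀ i, (q i).1 < (q i).2) → 1 ≤ R → (R : ℝ) * a β ≤ ℓ₄ → 4 * R + 8 ≤ L → (∀ i j : Fin n, i ≠ j → ∃ k : Fin 4, (2 * (R : ℤ) + 4) ≤ |((((x i k - x j k : ℤ) : ZMod (2 * L + 1))).valMinAbs : ℤ)|) → let E : (LGConfig 4 G → ℝ) → ℝ := fun F => ∫ U, F (torusLift (2 * L + 1) U)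 ∂(wilsonMeasure (d := 4) (L := 2 * L + 1) r.ρ β); let Pl : Fin 4 × Fin 4 → (Fin 4 → ℤ) → LGConfig 4 G → ℝ := fun p y U => plaquetteObs r.ρ 0 p.1 p.2 (configShift (-y) U); |E (fun U => ∏ i, (Pl (q i) (x i) U - E (Pl (q i) (x i))))| ≤ (C / (R : ℝ) ^ 4) ^ n) → ∀ (sch : SpeciesScheme (YMSpecies G)), (∀ k, sch.a k = a (sch.β k)) → Filter.Tendsto sch.β Filter.atTop Filter.atTop → (∀ k, 0 ≤ sch.β k ∧ sch.a k ≤ 1 / 24 ∧ 14 ≤ sch.L k ∧ (sch.a k)⁻¹ * (sch.a k)⁻¹ ≤ sch.L k) → ∃ r₀ : ℝ, 0 < r₀ ∧ ∀ (n : ℕ), 2 ≤ n → ∀ (F D : SchwartzMap (Fin n → EuclideanSpace ℝ (Fin 4)) ℂ), IsOffDiagonal F → HasCompactSupport (F : (Fin n → EuclideanSpace ℝ (Fin 4)) → ℂ) → (∃ δ : ℝ, 0 < δ ∧ tsupport (F : (Fin n → EuclideanSpace ℝ (Fin 4)) → ℂ) ⊆ {x | ∀ i j, i ≠ j → δ ≤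 dist (x i) (x j)}) → tsupport (F : (Fin n → EuclideanSpace ℝ (Fin 4)) → ℂ) ⊆ {x | ∀ i j, dist (x i) (x j) < r₀} → (∀ x, D x = fderiv ℝ (F : (Fin n → EuclideanSpace ℝ (Fin 4)) → ℂ) x (fun k => (x k 0) • (EuclideanSpace.single 1 1 : EuclideanSpace ℝ (Fin 4)) - (x k 1) • (EuclideanSpace.single 0 1 : EuclideanSpace ℝ (Fin 4)))) → Filter.Tendsto (fun k : ℕ => ∑ x ∈ Fintype.piFinset (fun _ : Fin n => box 4 (sch.L k)), (((∫ U, ∏ i, (r.curvature.F (configShift (-(x i)) (torusLift (2 * sch.L k + 1) U)) - ∫ V, r.curvature.F (torusLift (2 * sch.L k + 1) V) ∂(wilsonMeasure (d := 4) (L := 2 * sch.L k + 1) r.ρ (sch.β k))) ∂(wilsonMeasure (d := 4) (L := 2 * sch.L k + 1) r.ρ (sch.β k)) : ℝ) : ℂ) * D (fun i => sch.a k • siteToE (x i)))) Filter.atTop (nhds 0) := by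
  sorry

/-! ## The composition — the crux BY NAME from the three stub statements (proof = the landed glue, no sorry) -/

/-- **`OSLegsAtWeakCouplingC` from the line's three stubs**, in implication form: the hypotheses are the statements of
`stub_uvHyperscaling`, `stub_largeTorusNonTriviality`, `stub_latticeWardGerm` verbatim, the conclusion is the route decl
`Summit.QuantumFields.YangMills.Theses.LangevinControlUV.OSLegsAtWeakCouplingC`, and the proof is the landed def-free glue
`Sketch.osLegsAtWeakCouplingC_of_subs` (Theorems/LangevinControlUVOSLegsAtWeakCouplingCSketchSplit.lean, p140922). -/
theorem OSLegsAtWeakCouplingC_of :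
    (open Literature.MathematicalPhysics.QuantumLattice Literature.MathematicalPhysics.AQFT Literature.MathematicalPhysics.QuantumFieldTheory Literature.Probability.LatticeModels in ∀ (G : Type) [Group G] [TopologicalSpace G] [IsTopologicalGroup G] [CompactSpace G], IsCompactSimpleLieGroup G → letI : MeasurableSpace G := borel G; haveI : BorelSpace G := ⟨rfl⟩; ∀ (r : LatticeRep G), ∀ (a : ℝ → ℝ), Continuous a → (∃ (Γ : ℝ → ℝ) (β₀ ℓ₀ c C : ℝ), 0 < ℓ₀ ∧ 0 < c ∧ (∀ β, 0 < a β) ∧ Filter.Tendsto a Filter.atTop (nhds 0) ∧ (∀ s : ℝ, 0 < s → s ≤ ℓ₀ → 0 < Γ s ∧ Γ s ≤ 1) ∧ ∀ (L : ℕ) [NeZero L] (β : ℝ), β₀ ≤ β → (L : ℝ) * a β ≤ ℓ₀ → let P : (Fin 4 → ZMod L) → Fin 4 → Fin 4 → GaugeConfig 4 L G → ℝ := fun x i j U => (r.N : ℝ) - (r.ρ (plaquetteHolonomy U x i j)).trace.re; let E : (GaugeConfig 4 L G → ℝ) → ℝ := fun F => wilsonExpectation (d := 4) (L := L) r.ρ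 β F; let cov : (GaugeConfig 4 L G → ℝ) → (GaugeConfig 4 L G → ℝ) → ℝ := fun F F' => E (fun U => F U * F' U) - E F * E F'; let dist : (Fin 4 → ZMod L) → (Fin 4 → ZMod L) → ℝ := fun x y => Real.sqrt (∑ k : Fin 4, (((x k - y k).valMinAbs : ℤ) : ℝ) ^ 2); (∀ n : ℕ, 1 ≤ n → 8 * n ≤ L → c * Γ ((n : ℝ) * a β) ≤ (n : ℝ) ^ 8 * cov (P 0 0 1) (P (Pi.single (2 : Fin 4) ((n : ℕ) : ZMod L)) 0 1) ∧ (n : ℝ) ^ 8 * cov (P 0 0 1) (P (Pi.single (2 : Fin 4) ((n : ℕ) : ZMod L)) 0 1) ≤ C * Γ ((n : ℝ) * a β)) ∧ (∀ (x y : Fin 4 → ZMod L) (i j i' j' : Fin 4), x ≠ y → i ≠ j → i' ≠ j' → |cov (P x i j) (P y i' j')| * dist x y ^ 8 ≤ C * Γ (dist x y * a β))) → (∃ (Γ₃ : ℝ → ℝ) (β₁ ℓ₁ c₃ : ℝ), 0 < ℓ₁ ∧ 0 < c₃ ∧ (∀ s : ℝ, 0 < s → s ≤ ℓ₁ → 0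 < Γ₃ s) ∧ ∀ (L : ℕ) [NeZero L] (β : ℝ), β₁ ≤ β → (L : ℝ) * a β ≤ ℓ₁ → let P : (Fin 4 → ZMod L) → Fin 4 → Fin 4 → GaugeConfig 4 L G → ℝ := fun x i j U => (r.N : ℝ) - (r.ρ (plaquetteHolonomy U x i j)).trace.re; let E : (GaugeConfig 4 L G → ℝ) → ℝ := fun F => wilsonExpectation (d := 4) (L := L) r.ρ β F; let cov : (GaugeConfig 4 L G → ℝ) → (GaugeConfig 4 L G → ℝ) → ℝ := fun F F' => E (fun U => F U * F' U) - E F * E F'; ∀ n : ℕ, 1 ≤ n → 8 * n ≤ L → c₃ * Γ₃ ((n : ℝ) * a β) ≤ (n : ℝ) ^ 12 * |E (fun U => P 0 0 1 U * P (Pi.single (2 : Fin 4) ((n : ℕ) : ZMod L)) 0 1 U * P (Pi.single (3 : Fin 4) ((n : ℕ) : ZMod L)) 0 1 U) - E (P 0 0 1) * cov (P (Pi.single (2 : Fin 4) ((n : ℕ) : ZMod L)) 0 1) (P (Pi.single (3 : Fin 4) ((n : ℕ) : ZMod L)) 0 1) - E (P (Pi.single (2 : Fin 4) ((n : ℕ)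 : ZMod L)) 0 1) * cov (P 0 0 1) (P (Pi.single (3 : Fin 4) ((n : ℕ) : ZMod L)) 0 1) - E (P (Pi.single (3 : Fin 4) ((n : ℕ) : ZMod L)) 0 1) * cov (P 0 0 1) (P (Pi.single (2 : Fin 4) ((n : ℕ) : ZMod L)) 0 1) - E (P 0 0 1) * E (P (Pi.single (2 : Fin 4) ((n : ℕ) : ZMod L)) 0 1) * E (P (Pi.single (3 : Fin 4) ((n : ℕ) : ZMod L)) 0 1)|) → (∃ (c₁ β₂ : ℝ) (S₁ : ℝ → ℕ), 0 < c₁ ∧ ∀ A B : YMSpecies G, ∃ C : ℝ, ∀ β : ℝ, β₂ ≤ β → ∀ S n : ℕ, S₁ β ≤ S → n ≤ S → |latticeConnectedCorr r.ρ β (2 * S + 1) A.F B.F n| ≤ C * Real.exp (-(c₁ * a β * n))) → ∃ (C β₄ ℓ₄ : ℝ), 0 < ℓ₄ ∧ 0 ≤ C ∧ ∀ β : ℝ, β₄ ≤ β → ∀ (L n : ℕ) (q : Fin n → Fin 4 × Fin 4) (x : Fin n → (Fin 4 → ℤ)) (R : ℕ), (∀ i, (q i).1 < (q i).2) → 1 ≤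 R → (R : ℝ) * a β ≤ ℓ₄ → 4 * R + 8 ≤ L → (∀ i j : Fin n, i ≠ j → ∃ k : Fin 4, (2 * (R : ℤ) + 4) ≤ |((((x i k - x j k : ℤ) : ZMod (2 * L + 1))).valMinAbs : ℤ)|) → let E : (LGConfig 4 G → ℝ) → ℝ := fun F => ∫ U, F (torusLift (2 * L + 1) U) ∂(wilsonMeasure (d := 4) (L := 2 * L + 1) r.ρ β); let Pl : Fin 4 × Fin 4 → (Fin 4 → ℤ) → LGConfig 4 G → ℝ := fun p y U => plaquetteObs r.ρ 0 p.1 p.2 (configShift (-y) U); |E (fun U => ∏ i, (Pl (q i) (x i) U - E (Pl (q i) (x i))))| ≤ (C / (R : ℝ) ^ 4) ^ n) →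
    (open Literature.MathematicalPhysics.QuantumLattice Literature.MathematicalPhysics.AQFT Literature.MathematicalPhysics.QuantumFieldTheory Literature.Probability.LatticeModels in ∀ (G : Type) [Group G] [TopologicalSpace G] [IsTopologicalGroup G] [CompactSpace G], IsCompactSimpleLieGroup G → letI : MeasurableSpace G := borel G; haveI : BorelSpace G := ⟨rfl⟩; ∀ (r : LatticeRep G), ∀ (a : ℝ → ℝ), Continuous a → (∃ (Γ : ℝ → ℝ) (β₀ ℓ₀ c C : ℝ), 0 < ℓ₀ ∧ 0 < c ∧ (∀ β, 0 < a β) ∧ Filter.Tendsto a Filter.atTop (nhds 0) ∧ (∀ s : ℝ, 0 < s → s ≤ ℓ₀ → 0 < Γ s ∧ Γ s ≤ 1) ∧ ∀ (L : ℕ) [NeZero L] (β : ℝ), β₀ ≤ β → (L : ℝ) * a β ≤ ℓ₀ → let P : (Fin 4 → ZMod L) → Fin 4 → Fin 4 → GaugeConfig 4 L G → ℝ := fun x i j U => (r.N : ℝ) - (r.ρ (plaquetteHolonomy U x i j)).trace.re; let E : (GaugeConfig 4 L G → ℝ) → ℝ := fun F => wilsonExpectation (d := 4) (L := L) r.ρ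 β F; let cov : (GaugeConfig 4 L G → ℝ) → (GaugeConfig 4 L G → ℝ) → ℝ := fun F F' => E (fun U => F U * F' U) - E F * E F'; let dist : (Fin 4 → ZMod L) → (Fin 4 → ZMod L) → ℝ := fun x y => Real.sqrt (∑ k : Fin 4, (((x k - y k).valMinAbs : ℤ) : ℝ) ^ 2); (∀ n : ℕ, 1 ≤ n → 8 * n ≤ L → c * Γ ((n : ℝ) * a β) ≤ (n : ℝ) ^ 8 * cov (P 0 0 1) (P (Pi.single (2 : Fin 4) ((n : ℕ) : ZMod L)) 0 1) ∧ (n : ℝ) ^ 8 * cov (P 0 0 1) (P (Pi.single (2 : Fin 4) ((n : ℕ) : ZMod L)) 0 1) ≤ C * Γ ((n : ℝ) * a β)) ∧ (∀ (x y : Fin 4 → ZMod L) (i j i' j' : Fin 4), x ≠ y → i ≠ j → i' ≠ j' → |cov (P x i j) (P y i' j')| * dist x y ^ 8 ≤ C * Γ (dist x y * a β))) → (∃ (Γ₃ : ℝ → ℝ) (β₁ ℓ₁ c₃ : ℝ), 0 < ℓ₁ ∧ 0 < c₃ ∧ (∀ s : ℝ, 0 < s → s ≤ ℓ₁ → 0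 < Γ₃ s) ∧ ∀ (L : ℕ) [NeZero L] (β : ℝ), β₁ ≤ β → (L : ℝ) * a β ≤ ℓ₁ → let P : (Fin 4 → ZMod L) → Fin 4 → Fin 4 → GaugeConfig 4 L G → ℝ := fun x i j U => (r.N : ℝ) - (r.ρ (plaquetteHolonomy U x i j)).trace.re; let E : (GaugeConfig 4 L G → ℝ) → ℝ := fun F => wilsonExpectation (d := 4) (L := L) r.ρ β F; let cov : (GaugeConfig 4 L G → ℝ) → (GaugeConfig 4 L G → ℝ) → ℝ := fun F F' => E (fun U => F U * F' U) - E F * E F'; ∀ n : ℕ, 1 ≤ n → 8 * n ≤ L → c₃ * Γ₃ ((n : ℝ) * a β) ≤ (n : ℝ) ^ 12 * |E (fun U => P 0 0 1 U * P (Pi.single (2 : Fin 4) ((n : ℕ) : ZMod L)) 0 1 U * P (Pi.single (3 : Fin 4) ((n : ℕ) : ZMod L)) 0 1 U) - E (P 0 0 1) * cov (P (Pi.single (2 : Fin 4) ((n : ℕ) : ZMod L)) 0 1) (P (Pi.single (3 : Fin 4) ((n : ℕ) : ZMod L)) 0 1) - E (P (Pi.single (2 : Fin 4) ((n : ℕ)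 : ZMod L)) 0 1) * cov (P 0 0 1) (P (Pi.single (3 : Fin 4) ((n : ℕ) : ZMod L)) 0 1) - E (P (Pi.single (3 : Fin 4) ((n : ℕ) : ZMod L)) 0 1) * cov (P 0 0 1) (P (Pi.single (2 : Fin 4) ((n : ℕ) : ZMod L)) 0 1) - E (P 0 0 1) * E (P (Pi.single (2 : Fin 4) ((n : ℕ) : ZMod L)) 0 1) * E (P (Pi.single (3 : Fin 4) ((n : ℕ) : ZMod L)) 0 1)|) → (∃ (c₁ β₂ : ℝ) (S₁ : ℝ → ℕ), 0 < c₁ ∧ ∀ A B : YMSpecies G, ∃ C : ℝ, ∀ β : ℝ, β₂ ≤ β → ∀ S n : ℕ, S₁ β ≤ S → n ≤ S → |latticeConnectedCorr r.ρ β (2 * S + 1) A.F B.F n| ≤ C * Real.exp (-(c₁ * a β * n))) → ∃ (v f g h : SchwartzMap (EuclideanSpace ℝ (Fin 4)) ℝ) (ε β₅ Λ₅ : ℝ), tsupport v ⊆ {y : EuclideanSpace ℝ (Fin 4) | 0 < y 0} ∧ Disjoint (tsupport f) (tsupport g) ∧ Disjoint (tsupport g) (tsupport h) ∧ Disjoint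 (tsupport f) (tsupport h) ∧ 0 < ε ∧ ∀ β : ℝ, β₅ ≤ β → ∀ L : ℕ, Λ₅ ≤ a β * L → let E : (LGConfig 4 G → ℝ) → ℝ := fun F => ∫ U, F (torusLift (2 * L + 1) U) ∂(wilsonMeasure (d := 4) (L := 2 * L + 1) r.ρ β); let D : (Fin 4 → ℤ) → LGConfig 4 G → ℝ := fun x U => r.curvature.F (configShift (-x) U); (ε ≤ ∑ x ∈ box 4 L, ∑ y ∈ box 4 L, thetaTest 4 v (a β • siteToE x) * v (a β • siteToE y) * (E (fun U => D x U * D y U) - E (D x) * E (D y))) ∧ (ε ≤ |∑ x ∈ box 4 L, ∑ y ∈ box 4 L, ∑ z ∈ box 4 L, f (a β • siteToE x) * g (a β • siteToE y) * h (a β • siteToE z) * (E (fun U => D x U * D y U * D z U) - E (D x) * E (fun U => D y U * D z U) - E (D y) * E (fun U => D x U * D z U) - E (D z) * E (fun U => D x U * D y U) + 2 * (E (D x) * E (D y) * E (D z)))|)) →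
    (open Literature.MathematicalPhysics.QuantumLattice Literature.MathematicalPhysics.AQFT Literature.MathematicalPhysics.QuantumFieldTheory Literature.Probability.LatticeModels in ∀ (G : Type) [Group G] [TopologicalSpace G] [IsTopologicalGroup G] [CompactSpace G], IsCompactSimpleLieGroup G → letI : MeasurableSpace G := borel G; haveI : BorelSpace G := ⟨rfl⟩; ∀ (r : LatticeRep G), ∀ (a : ℝ → ℝ), Continuous a → (∃ (Γ : ℝ → ℝ) (β₀ ℓ₀ c C : ℝ), 0 < ℓ₀ ∧ 0 < c ∧ (∀ β, 0 < a β) ∧ Filter.Tendsto a Filter.atTop (nhds 0) ∧ (∀ s : ℝ, 0 < s → s ≤ ℓ₀ → 0 < Γ s ∧ Γ s ≤ 1) ∧ ∀ (L : ℕ) [NeZero L] (β : ℝ), β₀ ≤ β → (L : ℝ) * a β ≤ ℓ₀ → let P : (Fin 4 → ZMod L) → Fin 4 → Fin 4 → GaugeConfig 4 L G → ℝ := fun x i j U => (r.N : ℝ) - (r.ρ (plaquetteHolonomy U x i j)).trace.re; let E : (GaugeConfig 4 L G → ℝ) → ℝ := fun F => wilsonExpectation (d := 4) (L := L) r.ρ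 β F; let cov : (GaugeConfig 4 L G → ℝ) → (GaugeConfig 4 L G → ℝ) → ℝ := fun F F' => E (fun U => F U * F' U) - E F * E F'; let dist : (Fin 4 → ZMod L) → (Fin 4 → ZMod L) → ℝ := fun x y => Real.sqrt (∑ k : Fin 4, (((x k - y k).valMinAbs : ℤ) : ℝ) ^ 2); (∀ n : ℕ, 1 ≤ n → 8 * n ≤ L → c * Γ ((n : ℝ) * a β) ≤ (n : ℝ) ^ 8 * cov (P 0 0 1) (P (Pi.single (2 : Fin 4) ((n : ℕ) : ZMod L)) 0 1) ∧ (n : ℝ) ^ 8 * cov (P 0 0 1) (P (Pi.single (2 : Fin 4) ((n : ℕ) : ZMod L)) 0 1) ≤ C * Γ ((n : ℝ) * a β)) ∧ (∀ (x y : Fin 4 → ZMod L) (i j i' j' : Fin 4), x ≠ y → i ≠ j → i' ≠ j' → |cov (P x i j) (P y i' j')| * dist x y ^ 8 ≤ C * Γ (dist x y * a β))) → (∃ (c₁ β₂ : ℝ) (S₁ : ℝ → ℕ), 0 < c₁ ∧ ∀ A B : YMSpecies G, ∃ C : ℝ, ∀ β : ℝ, β₂ ≤ β → ∀ S n : ℕ,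 S₁ β ≤ S → n ≤ S → |latticeConnectedCorr r.ρ β (2 * S + 1) A.F B.F n| ≤ C * Real.exp (-(c₁ * a β * n))) → (∃ (C β₄ ℓ₄ : ℝ), 0 < ℓ₄ ∧ 0 ≤ C ∧ ∀ β : ℝ, β₄ ≤ β → ∀ (L n : ℕ) (q : Fin n → Fin 4 × Fin 4) (x : Fin n → (Fin 4 → ℤ)) (R : ℕ), (∀ i, (q i).1 < (q i).2) → 1 ≤ R → (R : ℝ) * a β ≤ ℓ₄ → 4 * R + 8 ≤ L → (∀ i j : Fin n, i ≠ j → ∃ k : Fin 4, (2 * (R : ℤ) + 4) ≤ |((((x i k - x j k : ℤ) : ZMod (2 * L + 1))).valMinAbs : ℤ)|) → let E : (LGConfig 4 G → ℝ) → ℝ := fun F => ∫ U, F (torusLift (2 * L + 1) U) ∂(wilsonMeasure (d := 4) (L := 2 * L + 1) r.ρ β); let Pl : Fin 4 × Fin 4 → (Fin 4 → ℤ) → LGConfig 4 G → ℝ := fun p y U => plaquetteObs r.ρ 0 p.1 p.2 (configShift (-y) U); |E (fun U => ∏ i, (Pl (q i) (x i) U - E (Pl (q i) (x i))))| ≤ (C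 / (R : ℝ) ^ 4) ^ n) → ∀ (sch : SpeciesScheme (YMSpecies G)), (∀ k, sch.a k = a (sch.β k)) → Filter.Tendsto sch.β Filter.atTop Filter.atTop → (∀ k, 0 ≤ sch.β k ∧ sch.a k ≤ 1 / 24 ∧ 14 ≤ sch.L k ∧ (sch.a k)⁻¹ * (sch.a k)⁻¹ ≤ sch.L k) → ∃ r₀ : ℝ, 0 < r₀ ∧ ∀ (n : ℕ), 2 ≤ n → ∀ (F D : SchwartzMap (Fin n → EuclideanSpace ℝ (Fin 4)) ℂ), IsOffDiagonal F → HasCompactSupport (F : (Fin n → EuclideanSpace ℝ (Fin 4)) → ℂ) → (∃ δ : ℝ, 0 < δ ∧ tsupport (F : (Fin n → EuclideanSpace ℝ (Fin 4)) → ℂ) ⊆ {x | ∀ i j, i ≠ j → δ ≤ dist (x i) (x j)}) → tsupport (F : (Fin n → EuclideanSpace ℝ (Fin 4)) → ℂ) ⊆ {x | ∀ i j, dist (x i) (x j) < r₀} → (∀ x, D x = fderiv ℝ (F : (Fin n → EuclideanSpace ℝ (Fin 4)) → ℂ) x (fun k => (x k 0) • (EuclideanSpace.single 1 1 : EuclideanSpace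 ℝ (Fin 4)) - (x k 1) • (EuclideanSpace.single 0 1 : EuclideanSpace ℝ (Fin 4)))) → Filter.Tendsto (fun k : ℕ => ∑ x ∈ Fintype.piFinset (fun _ : Fin n => box 4 (sch.L k)), (((∫ U, ∏ i, (r.curvature.F (configShift (-(x i)) (torusLift (2 * sch.L k + 1) U)) - ∫ V, r.curvature.F (torusLift (2 * sch.L k + 1) V) ∂(wilsonMeasure (d := 4) (L := 2 * sch.L k + 1) r.ρ (sch.β k))) ∂(wilsonMeasure (d := 4) (L := 2 * sch.L k + 1) r.ρ (sch.β k)) : ℝ) : ℂ) * D (fun i => sch.a k • siteToE (x i)))) Filter.atTop (nhds 0)) →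
    OSLegsAtWeakCouplingC :=
  osLegsAtWeakCouplingC_of_subs

/-- The same composition applied to the stubs (sorry-free modulo the three stubs): the crux as a closed term. -/
theorem osLegsAtWeakCouplingC_of_stubs : OSLegsAtWeakCouplingC :=
  OSLegsAtWeakCouplingC_of stub_uvHyperscaling stub_largeTorusNonTriviality stub_latticeWardGerm

end Summit.QuantumFields.YangMills.Cruxes.OSLegsAtWeakCouplingC.AxisCrossAnalyticityE1Locality
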